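import Summits.HubbardSuperconductivity.HubbardSuperconductivity.Theses.FunctionFieldCertificate
import Summits.HubbardSuperconductivity.HubbardSuperconductivity.Theorems.FunctionFieldCertificateMesoscopicPairOrderStubLowestWeightCriterion
import Summits.HubbardSuperconductivity.HubbardSuperconductivity.Theorems.FunctionFieldCertificateMesoscopicPairOrderStubPairAdditionBound
import Summits.HubbardSuperconductivity.HubbardSuperconductivity.Theorems.FunctionFieldCertificateMesoscopicPairOrderStubCornerWindow
import HarnessLib

/-!
# Crux `MesoscopicPairOrder` (item `stmt-HubbardSuperconductivity-7331`), line `SketchIdeator4`: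
# the η clause of the load-bearing stub is dischargeable — the stub is the crux confined to the η-corner

With the three landed stubs of the line (`stub_lowestWeightCriterion` p124790,
`stub_pairAdditionBound` p125295, `stub_cornerWindow` p125420) the hypothesis
`etaLower torusStagger *ᵥ ψ = 0` handed to the load-bearing stub `stub_etaCornerOrder`
(`Cruxes/MesoscopicPairOrder/Lines/SketchIdeator4.lean`) holds for EVERY `(N_L, 0)`-sector ground
state at every `(U, δ)` of the η-corner `δ ∈ (1/3, 1/2)`, `U > 8(1-δ)/(3δ-1)` and every even
`L ≥ 2` (`eta_annihilates_groundStates_in_corner`). Hence the registered signature of the stub is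
EQUIVALENT to the crux body restricted to the η-corner with NO η clause
(`etaCornerOrder_iff_cornerOrder`; in the notation of the disprover's workfile this is
`∃ U > 0, ∃ δ ∈ (1/3,1/2), 8(1-δ)/(3δ-1) < U ∧ MesoscopicPairOrderAt U δ`), which is a STRENGTHENING
of `MesoscopicPairOrder` — the same body with fewer admissible witnesses `(U, δ)`
(`mesoscopicPairOrder_of_cornerOrder`). Together with the negative lemma
`etaCornerBody_false_without_groundState` (`…EtaIdle.lean`: the η clause without minimality carries
no pair order) the η clause is idle on both sides: the line's only open stub is the crux confined to a
sub-region of the parameter range, with no lever left inside the line.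

No definition is introduced (both statements are spelled out verbatim). Yang, PRL 63 (1989) 2144;
Yang–Zhang, Mod. Phys. Lett. B 4 (1990) 759; folklore.
-/

noncomputable section

-- the summit namespace repeats the problem name by design (D-0017)
set_option linter.dupNamespace false

namespace Summit.HubbardSuperconductivity.HubbardSuperconductivity.Theorems.FunctionFieldCertificate

open Matrix Finset Filter
open Literature.Probability.LatticeModels Literature.MathematicalPhysics.QuantumLattice
open Summit.HubbardSuperconductivity.HubbardSuperconductivity.Theses.FunctionFieldCertificate
open scoped ComplexOrder

/-- **In the η-corner every sector ground state is η-annihilated** (the line's stubs 1–3 chained):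
for `δ ∈ (1/3, 1/2)` and `U > 8(1-δ)/(3δ-1)` there is `L₁` such that for all even `L ≥ L₁` every
ground state `ψ` of the sector `(N_L, 0)`, `N_L = 2⌊(1-δ)L²/2⌋`, of `hubbardTorus 2 L 1 U` has
`η ψ = 0` (`stub_cornerWindow` fed with `stub_pairAdditionBound` writes `N_L = 2(n+1)` with a strict
pair chemical potential, and `stub_lowestWeightCriterion` concludes). Yang–Zhang, Mod. Phys. Lett.
B 4 (1990) 759, Theorem 1. [folklore] -/
theorem eta_annihilates_groundStates_in_corner {U δ : ℝ} (hδ : δ ∈ Set.Ioo (1 / 3 : ℝ) (1 / 2))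
    (hU : 8 * (1 - δ) / (3 * δ - 1) < U) :
    ∃ L₁ : ℕ, ∀ (L : ℕ) [NeZero L], L₁ ≤ L → Even L →
      ∀ ψ : Fock (Orb (FermionTorus 2 L)),
        IsGroundStateInSector (hubbardTorus 2 L 1 U) (2 * ⌊(1 - δ) * (L : ℝ) ^ 2 / 2⌋₊) 0 ψ →
          etaLower (torusStagger : FermionTorus 2 L → ℤˣ) *ᵥ ψ = 0 := by
  obtain ⟨L₁, hL₁⟩ := stub_cornerWindow stub_pairAdditionBound U δ hδ hU
  refine ⟨L₁, fun L _ hL hE ψ hgs => ?_⟩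
  obtain ⟨n, hn, h2n, hstrict⟩ := hL₁ L hL
  have hgs' : IsGroundStateInSector (hubbardTorus 2 L 1 U) (2 * (n + 1)) 0 ψ := by
    rw [← hn]; exact hgs
  exact stub_lowestWeightCriterion U L hE n h2n hstrict ψ hgs'

/-- **The η clause of `stub_etaCornerOrder` is dischargeable**: the registered signature of the
line's load-bearing stub (left) is equivalent to the crux body confined to the η-corner with no η
clause (right). (`→`: for `L` beyond both thresholds every sector ground state is η-annihilated by
`eta_annihilates_groundStates_in_corner`; `←`: drop the hypothesis.) [folklore] -/
theorem etaCornerOrder_iff_cornerOrder :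
    (∃ U : ℝ, 0 < U ∧ ∃ δ ∈ Set.Ioo (1 / 3 : ℝ) (1 / 2),
      8 * (1 - δ) / (3 * δ - 1) < U ∧
      ∃ m : ℝ, 0 < m ∧ ∀ R₀ : ℕ, ∃ R : ℕ, R₀ ≤ R ∧ ∃ L₀ : ℕ, ∀ (L : ℕ) [NeZero L], L₀ ≤ L → Even L →
        ∀ ψ : Fock (Orb (FermionTorus 2 L)), star ψ ⬝ᵥ ψ = 1 →
          IsGroundStateInSector (hubbardTorus 2 L 1 U) (2 * ⌊(1 - δ) * (L : ℝ) ^ 2 / 2⌋₊) 0 ψ →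
            etaLower (torusStagger : FermionTorus 2 L → ℤˣ) *ᵥ ψ = 0 →
              m * (R : ℝ) ^ 2 ≤ (∑ x : TorusSite 2 L, ∑ y : TorusSite 2 L,
                (∏ i : Fin 2, max 0 (1 - |(((y i - x i).valMinAbs : ℤ) : ℝ)| / (R : ℝ))) *
                  (star (localPair dWaveFormFactor L x *ᵥ ψ) ⬝ᵥ
                    (localPair dWaveFormFactor L y *ᵥ ψ)).re) / (L : ℝ) ^ 2) ↔
    (∃ U : ℝ, 0 < U ∧ ∃ δ ∈ Set.Ioo (1 / 3 : ℝ) (1 / 2),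
      8 * (1 - δ) / (3 * δ - 1) < U ∧
      ∃ m : ℝ, 0 < m ∧ ∀ R₀ : ℕ, ∃ R : ℕ, R₀ ≤ R ∧ ∃ L₀ : ℕ, ∀ (L : ℕ) [NeZero L], L₀ ≤ L → Even L →
        ∀ ψ : Fock (Orb (FermionTorus 2 L)), star ψ ⬝ᵥ ψ = 1 →
          IsGroundStateInSector (hubbardTorus 2 L 1 U) (2 * ⌊(1 - δ) * (L : ℝ) ^ 2 / 2⌋₊) 0 ψ →
            m * (R : ℝ) ^ 2 ≤ (∑ x : TorusSite 2 L, ∑ y : TorusSite 2 L,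
              (∏ i : Fin 2, max 0 (1 - |(((y i - x i).valMinAbs : ℤ) : ℝ)| / (R : ℝ))) *
                (star (localPair dWaveFormFactor L x *ᵥ ψ) ⬝ᵥ
                  (localPair dWaveFormFactor L y *ᵥ ψ)).re) / (L : ℝ) ^ 2) := by
  constructor
  · rintro ⟨U, hU, δ, hδ, hUδ, m, hm, hall⟩
    obtain ⟨L₁, hL₁⟩ := eta_annihilates_groundStates_in_corner hδ hUδ
    refine ⟨U, hU, δ, hδ, hUδ, m, hm, fun R₀ => ?_⟩
    obtain ⟨R, hR₀, L₀, hL⟩ := hall R₀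
    refine ⟨R, hR₀, max L₀ L₁, fun L _ hLge hE ψ hψ hgs => ?_⟩
    exact hL L (le_of_max_le_left hLge) hE ψ hψ hgs
      (hL₁ L (le_of_max_le_right hLge) hE ψ hgs)
  · rintro ⟨U, hU, δ, hδ, hUδ, m, hm, hall⟩
    refine ⟨U, hU, δ, hδ, hUδ, m, hm, fun R₀ => ?_⟩
    obtain ⟨R, hR₀, L₀, hL⟩ := hall R₀
    exact ⟨R, hR₀, L₀, fun L _ hL₀ hE ψ hψ hgs _ => hL L hL₀ hE ψ hψ hgs⟩

/-- **The corner body is a strengthening of the crux** (`(1/3, 1/2) ⊂ (0, 1/2)`): the line's only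
open stub is `MesoscopicPairOrder` with its witness `(U, δ)` confined to the η-corner. [folklore] -/
theorem mesoscopicPairOrder_of_cornerOrder
    (h : ∃ U : ℝ, 0 < U ∧ ∃ δ ∈ Set.Ioo (1 / 3 : ℝ) (1 / 2),
      8 * (1 - δ) / (3 * δ - 1) < U ∧
      ∃ m : ℝ, 0 < m ∧ ∀ R₀ : ℕ, ∃ R : ℕ, R₀ ≤ R ∧ ∃ L₀ : ℕ, ∀ (L : ℕ) [NeZero L], L₀ ≤ L → Even L →
        ∀ ψ : Fock (Orb (FermionTorus 2 L)), star ψ ⬝ᵥ ψ = 1 →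
          IsGroundStateInSector (hubbardTorus 2 L 1 U) (2 * ⌊(1 - δ) * (L : ℝ) ^ 2 / 2⌋₊) 0 ψ →
            m * (R : ℝ) ^ 2 ≤ (∑ x : TorusSite 2 L, ∑ y : TorusSite 2 L,
              (∏ i : Fin 2, max 0 (1 - |(((y i - x i).valMinAbs : ℤ) : ℝ)| / (R : ℝ))) *
                (star (localPair dWaveFormFactor L x *ᵥ ψ) ⬝ᵥ
                  (localPair dWaveFormFactor L y *ᵥ ψ)).re) / (L : ℝ) ^ 2) :
    MesoscopicPairOrder := by
  obtain ⟨U, hU, δ, hδ, -, m, hm, hall⟩ := h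
  exact ⟨U, hU, δ, ⟨by linarith [hδ.1], hδ.2⟩, m, hm, hall⟩

/-- **So the registered stub implies the crux in one line** (the skeleton's composition, restated
through the equivalence). [folklore] -/
theorem mesoscopicPairOrder_of_etaCornerOrder
    (h : ∃ U : ℝ, 0 < U ∧ ∃ δ ∈ Set.Ioo (1 / 3 : ℝ) (1 / 2),
      8 * (1 - δ) / (3 * δ - 1) < U ∧
      ∃ m : ℝ, 0 < m ∧ ∀ R₀ : ℕ, ∃ R : ℕ, R₀ ≤ R ∧ ∃ L₀ : ℕ, ∀ (L : ℕ) [NeZero L], L₀ ≤ L → Even L →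
        ∀ ψ : Fock (Orb (FermionTorus 2 L)), star ψ ⬝ᵥ ψ = 1 →
          IsGroundStateInSector (hubbardTorus 2 L 1 U) (2 * ⌊(1 - δ) * (L : ℝ) ^ 2 / 2⌋₊) 0 ψ →
            etaLower (torusStagger : FermionTorus 2 L → ℤˣ) *ᵥ ψ = 0 →
              m * (R : ℝ) ^ 2 ≤ (∑ x : TorusSite 2 L, ∑ y : TorusSite 2 L,
                (∏ i : Fin 2, max 0 (1 - |(((y i - x i).valMinAbs : ℤ) : ℝ)| / (R : ℝ))) *
                  (star (localPair dWaveFormFactor L x *ᵥ ψ) ⬝ᵥ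
                    (localPair dWaveFormFactor L y *ᵥ ψ)).re) / (L : ℝ) ^ 2) :
    MesoscopicPairOrder :=
  mesoscopicPairOrder_of_cornerOrder (etaCornerOrder_iff_cornerOrder.1 h)

/-- **The card's deliverable, unconditional in the η-corner: exact two-sided ground-state
annihilator constraints.** For `δ ∈ (1/3, 1/2)`, `U > 8(1-δ)/(3δ-1)` and all even `L ≥ L₁`, every
ground state `ψ` of the sector `(N_L, 0)` satisfies `⟨ψ, X η ψ⟩ = 0` for EVERY matrix `X` (any range,
any degree, not sector-preserving) — linear equalities valid on ground states only, usable with free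
multipliers in any finite-range relaxation at that `(U, δ)` — and in particular the staggered on-site
pair structure factor vanishes, `⟨ηψ, ηψ⟩ = ⟨ψ, η†η ψ⟩ = 0`. Zhang, PRL 65 (1990) 120; Yang–Zhang,
Mod. Phys. Lett. B 4 (1990) 759. [folklore] -/
theorem groundState_eta_constraints_in_corner {U δ : ℝ} (hδ : δ ∈ Set.Ioo (1 / 3 : ℝ) (1 / 2))
    (hU : 8 * (1 - δ) / (3 * δ - 1) < U) :
    ∃ L₁ : ℕ, ∀ (L : ℕ) [NeZero L], L₁ ≤ L → Even L →
      ∀ ψ : Fock (Orb (FermionTorus 2 L)),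
        IsGroundStateInSector (hubbardTorus 2 L 1 U) (2 * ⌊(1 - δ) * (L : ℝ) ^ 2 / 2⌋₊) 0 ψ →
          (∀ X : Matrix (Finset (Orb (FermionTorus 2 L))) (Finset (Orb (FermionTorus 2 L))) ℂ,
              star ψ ⬝ᵥ ((X * etaLower (torusStagger : FermionTorus 2 L → ℤˣ)) *ᵥ ψ) = 0) ∧
            star (etaLower (torusStagger : FermionTorus 2 L → ℤˣ) *ᵥ ψ) ⬝ᵥ
              (etaLower (torusStagger : FermionTorus 2 L → ℤˣ) *ᵥ ψ) = 0 := by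
  obtain ⟨L₁, hL₁⟩ := eta_annihilates_groundStates_in_corner hδ hU
  refine ⟨L₁, fun L _ hL hE ψ hgs => ?_⟩
  have h0 := hL₁ L hL hE ψ hgs
  refine ⟨fun X => ?_, by rw [h0]; simp⟩
  rw [← mulVec_mulVec, h0, mulVec_zero, dotProduct_zero]

end Summit.HubbardSuperconductivity.HubbardSuperconductivity.Theorems.FunctionFieldCertificate
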